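import Mathlib
import HarnessLib

/-!
# Route `RadicialJung`, crux `CleanModels` (stmt-ResolutionOfSingularities-15917), line `Sketch` rev 35, stub 6 `stub_cleanProp44` (X44c),
# `τ = 1` residual: THE CORNER `λ' ≡ 0` OF THE δ-DESCENT ((B5′) of memo 4e §2.6 (d)) — weak descent and uniqueness at rational points

Seat decomp-res-hand-2 g12 (structural hand), companion of `…BirthDescent.lean` (the degree count of memo 4e §2.5/§2.6 (c), which needs `F' ≠ 0`).
Memo `Cruxes/CleanModels/Lines/Sketch-memo-4e-cleanPermissible.md` §2.6 (d) isolates the one corner of the births termination (B′) of stub 6 that is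
not settled by hand: «CONSTANT-TYPE births», `λ' ≡ 0`, i.e. the restricted unit `F = U|_{Γ''} ∈ κ(c)[u^p]` with `F ∉ κ(c)[u]^p` (imperfect residue
field `κ(c)` only), where «`ν(c')` can be as large as `δ` and the degree count says nothing».  This file proves, with NO scheme theory, what plain
algebra still says in that corner at the `κ(c)`-RATIONAL closed points `c' = (u − α)` of `Γ'' ≅ ℙ¹` (dictionary as in `…BirthDescent.lean`:
`δ = p·d ≥ deg F`, `ν(c') = sup_G ord_{u−α}(F − G^p)`, births have `δ*(c') ≤ ν(c')`):

* `births_corner_normalForm` (at `α = 0`) / `births_corner_normalForm_at`: if `F' = 0`, `deg F ≤ p d` and `(u − α)^{pd} ∣ F − G^p`, then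
  `F = P^p + a·(u − α)^{pd}` — MAXIMAL CONTACT NORMAL FORM of a non-descending constant-type birth.
* `births_corner_not_dvd` — **WEAK DESCENT `ν(c') ≤ δ`**: if moreover `F` is not a `p`-th power then `(u − α)^{pd+1} ∤ F − G^p` for every `G`
  (so in the corner `δ*` is still NON-INCREASING along birth chains through rational points: `δ*(c') ≤ ν(c') ≤ δ`).
* `births_corner_unique` — **AT MOST ONE NON-DESCENDING RATIONAL BIRTH PER GENERATION**: if `(u − α)^{pd} ∣ F − G₁^p` and `(u − β)^{pd} ∣ F − G₂^p`
  with `d ≥ 1` and `F ∉ κ[u]^p`, then `α = β` (evaluate `a₁(Y − α^p)^d − a₂(Y − β^p)^d ∈ κ^p[Y]` at `Y = α^p`).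

So the residual (B5′) at rational points is an UNBRANCHED chain of maximal-contact births `c ← c' ← ⋯` with `δ*` constant — the shape of the memo's
dissolved example (§2.6 (d): the chain was carried by a curve of `Σ_μ` inside a wiggle of the leaf, which the strategy blows up); non-rational
closed points of `Γ''` in the corner are NOT treated here.

Honest framing: OURS, elementary (`Polynomial.expand`/`contract`, Frobenius); nothing here proves (B5′), the hypotheses of
`cleanProp44_of_tauOneResidual`, X44c, any case of `CleanModels`, or resolution of singularities in characteristic `p`.  Setting only:
[cite: CossartPiltant2008, Lemma 4.3 (5), Prop. 4.4] [cite: CossartJannsenSaito2020, Thm. 4.22, Cor. 4.23, Rem. 6.29].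
-/

set_option linter.dupNamespace false -- mandated namespace of this single-conjunct summit

open Polynomial Finset

namespace Summit.ResolutionOfSingularities.ResolutionOfSingularities.Theorems.RadicialJung.CleanModels

/-! ## §1 Coefficients of `p`-th powers and of polynomials with zero derivative -/

/-- In characteristic `p`, the coefficient of `u^{pk}` in `G^p` is `(G_k)^p`. [folklore] -/
theorem births_coeff_pow_char_mul {K : Type*} [CommRing K] (p : ℕ) [Fact p.Prime] [CharP K p] (G : K[X]) (k : ℕ) :
    (G ^ p).coeff (p * k) = G.coeff k ^ p := by
  have hp0 : 0 < p := (Fact.out : p.Prime).pos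
  rw [← map_frobenius_expand, coeff_map, coeff_expand hp0, if_pos (dvd_mul_right p k), Nat.mul_div_cancel_left k hp0,
    frobenius_def]

/-- **Maximal contact normal form at `u = 0`**: `F' = 0`, `deg F ≤ p d` and `u^{pd} ∣ F − G^p` force
`F = (Σ_{k<d} G_k u^k)^p + F_{pd} · u^{pd}`. [folklore] -/
theorem births_corner_normalForm {K : Type*} [Field K] (p : ℕ) [Fact p.Prime] [CharP K p] {F G : K[X]} {d : ℕ}
    (hF' : derivative F = 0) (hdeg : F.natDegree ≤ p * d) (hdvd : X ^ (p * d) ∣ F - G ^ p) :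
    F = (∑ k ∈ Finset.range d, C (G.coeff k) * X ^ k) ^ p + C (F.coeff (p * d)) * X ^ (p * d) := by
  have hp : p.Prime := Fact.out
  have hp0 : 0 < p := hp.pos
  set Φ := contract p F with hΦdef
  have hΦ : expand K p Φ = F := expand_contract p hF' hp.ne_zero
  have hcoeffF : ∀ k, F.coeff (p * k) = Φ.coeff k := by
    intro k
    rw [← hΦ, coeff_expand hp0, if_pos (dvd_mul_right p k), Nat.mul_div_cancel_left k hp0]
  have hlow : ∀ k < d, Φ.coeff k = G.coeff k ^ p := by
    intro k hk
    have h0 : (F - G ^ p).coeff (p * k) = 0 :=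
      (X_pow_dvd_iff.mp hdvd) (p * k) (Nat.mul_lt_mul_of_pos_left hk hp0)
    rwa [coeff_sub, hcoeffF, births_coeff_pow_char_mul p G k, sub_eq_zero] at h0
  have hΦdeg : Φ.natDegree ≤ d := by
    have h := natDegree_expand p Φ
    rw [hΦ] at h
    have h' : Φ.natDegree * p ≤ d * p := by rw [← h, mul_comm d p]; exact hdeg
    exact Nat.le_of_mul_le_mul_right h' hp0
  -- `Φ = frob(H) + Φ_d u^d` with `H = Σ_{k<d} G_k u^k`
  set H : K[X] := ∑ k ∈ Finset.range d, C (G.coeff k) * X ^ k with hHdef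
  have hmapH : map (frobenius K p) H = ∑ k ∈ Finset.range d, C (Φ.coeff k) * X ^ k := by
    rw [hHdef, Polynomial.map_sum]
    refine Finset.sum_congr rfl fun k hk => ?_
    rw [Polynomial.map_mul, Polynomial.map_pow, map_C, map_X, frobenius_def, hlow k (Finset.mem_range.mp hk)]
  have hΦsum : Φ = map (frobenius K p) H + C (F.coeff (p * d)) * X ^ d := by
    have h := as_sum_range' Φ (d + 1) (by omega)
    simp only [← C_mul_X_pow_eq_monomial] at h
    rw [Finset.sum_range_succ] at h
    rw [hmapH, hcoeffF d]
    exact h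
  calc F = expand K p Φ := hΦ.symm
    _ = expand K p (map (frobenius K p) H) + C (F.coeff (p * d)) * X ^ (p * d) := by
        rw [hΦsum, map_add, map_mul, expand_C, map_pow, expand_X, ← pow_mul]
    _ = H ^ p + C (F.coeff (p * d)) * X ^ (p * d) := by
        rw [← map_expand, map_frobenius_expand]

/-- If `u^{pd+1} ∣ F − G^p` (one order more), then `F` is a `p`-th power. [folklore] -/
theorem births_corner_eq_pow {K : Type*} [Field K] (p : ℕ) [Fact p.Prime] [CharP K p] {F G : K[X]} {d : ℕ}
    (hF' : derivative F = 0) (hdeg : F.natDegree ≤ p * d) (hdvd : X ^ (p * d + 1) ∣ F - G ^ p) :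
    ∃ H : K[X], F = H ^ p := by
  have hdvd' : X ^ (p * d) ∣ F - G ^ p := (pow_dvd_pow X (Nat.le_succ _)).trans hdvd
  have hnf := births_corner_normalForm p hF' hdeg hdvd'
  have htop : F.coeff (p * d) = G.coeff d ^ p := by
    have h0 : (F - G ^ p).coeff (p * d) = 0 := (X_pow_dvd_iff.mp hdvd) (p * d) (Nat.lt_succ_self _)
    rwa [coeff_sub, births_coeff_pow_char_mul p G d, sub_eq_zero] at h0
  refine ⟨(∑ k ∈ Finset.range d, C (G.coeff k) * X ^ k) + C (G.coeff d) * X ^ d, ?_⟩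
  rw [add_pow_char _ _ p, hnf, htop, map_pow, mul_pow, ← pow_mul, mul_comm d p]

/-! ## §2 Translation to a rational point `u = α` -/

/-- Undoing the translation: `(P ∘ (u + α)) ∘ (u − α) = P`. [folklore] -/
theorem births_comp_X_add_C_comp_X_sub_C {K : Type*} [CommRing K] (P : K[X]) (α : K) :
    (P.comp (X + C α)).comp (X - C α) = P := by
  rw [comp_assoc, add_comp, X_comp, C_comp, sub_add_cancel, comp_X]

/-- Translation: `(u − α)^n ∣ P ⟹ u^n ∣ P ∘ (u + α)`. [folklore] -/
theorem births_X_pow_dvd_comp_of_dvd {K : Type*} [CommRing K] {P : K[X]} {α : K} {n : ℕ} (h : (X - C α) ^ n ∣ P) :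
    X ^ n ∣ P.comp (X + C α) := by
  obtain ⟨Q, hQ⟩ := h
  refine ⟨Q.comp (X + C α), ?_⟩
  have h := congrArg (fun R : K[X] => R.comp (X + C α)) hQ
  simp only [mul_comp, pow_comp, sub_comp, X_comp, C_comp, add_sub_cancel_right] at h
  exact h

/-- Translation keeps a zero derivative. [folklore] -/
theorem births_derivative_comp_X_add_C_eq_zero {K : Type*} [CommRing K] {F : K[X]} (hF' : derivative F = 0) (α : K) :
    derivative (F.comp (X + C α)) = 0 := by
  rw [derivative_comp, hF', zero_comp, mul_zero]

/-- Translation keeps the degree. [folklore] -/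
theorem births_natDegree_comp_X_add_C {K : Type*} [Field K] (F : K[X]) (α : K) :
    (F.comp (X + C α)).natDegree = F.natDegree := by
  rw [natDegree_comp, natDegree_X_add_C, mul_one]

/-- Translation keeps «not a `p`-th power». [folklore] -/
theorem births_comp_ne_pow_of_ne_pow {K : Type*} [CommRing K] (p : ℕ) {F : K[X]} (hnot : ∀ H : K[X], F ≠ H ^ p) (α : K) :
    ∀ H : K[X], F.comp (X + C α) ≠ H ^ p := by
  intro H hH
  apply hnot (H.comp (X - C α))
  rw [← pow_comp, ← hH, births_comp_X_add_C_comp_X_sub_C]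

/-- **Maximal contact normal form at a rational point**: `F' = 0`, `deg F ≤ p d`, `(u − α)^{pd} ∣ F − G^p` force `F = P^p + a (u − α)^{pd}`.
[folklore] -/
theorem births_corner_normalForm_at {K : Type*} [Field K] (p : ℕ) [Fact p.Prime] [CharP K p] {F G : K[X]} {d : ℕ}
    (hF' : derivative F = 0) (hdeg : F.natDegree ≤ p * d) {α : K} (hdvd : (X - C α) ^ (p * d) ∣ F - G ^ p) :
    ∃ (P : K[X]) (a : K), F = P ^ p + C a * (X - C α) ^ (p * d) := by
  have hdvd₁ : X ^ (p * d) ∣ F.comp (X + C α) - (G.comp (X + C α)) ^ p := by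
    have h := births_X_pow_dvd_comp_of_dvd hdvd
    rwa [sub_comp, pow_comp] at h
  have hnf := births_corner_normalForm p (births_derivative_comp_X_add_C_eq_zero hF' α)
    ((births_natDegree_comp_X_add_C F α).le.trans hdeg) hdvd₁
  refine ⟨(∑ k ∈ Finset.range d, C ((G.comp (X + C α)).coeff k) * X ^ k).comp (X - C α),
    (F.comp (X + C α)).coeff (p * d), ?_⟩
  have h := congrArg (fun R : K[X] => R.comp (X - C α)) hnf
  simp only [births_comp_X_add_C_comp_X_sub_C, add_comp, pow_comp, mul_comp, C_comp, X_comp] at h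
  exact h

/-- **WEAK DESCENT IN THE CORNER, `ν(c') ≤ δ` at rational points**: `F' = 0`, `deg F ≤ p d = δ`, `F` not a `p`-th power ⟹ for every `G`,
`(u − α)^{pd+1} ∤ F − G^p` (memo 4e §2.6 (d): the corner value `ν = δ` is the maximum). [folklore] -/
theorem births_corner_not_dvd {K : Type*} [Field K] (p : ℕ) [Fact p.Prime] [CharP K p] {F : K[X]} {d : ℕ}
    (hF' : derivative F = 0) (hdeg : F.natDegree ≤ p * d) (hnot : ∀ H : K[X], F ≠ H ^ p) (α : K) (G : K[X]) :
    ¬ (X - C α) ^ (p * d + 1) ∣ F - G ^ p := by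
  intro hdvd
  have hdvd₁ : X ^ (p * d + 1) ∣ F.comp (X + C α) - (G.comp (X + C α)) ^ p := by
    have h := births_X_pow_dvd_comp_of_dvd hdvd
    rwa [sub_comp, pow_comp] at h
  obtain ⟨H, hH⟩ := births_corner_eq_pow p (births_derivative_comp_X_add_C_eq_zero hF' α)
    ((births_natDegree_comp_X_add_C F α).le.trans hdeg) hdvd₁
  exact births_comp_ne_pow_of_ne_pow p hnot α H hH

/-! ## §3 At most one non-descending rational birth -/

/-- In characteristic `p`: `(u − α)^{pd} = expand_p ((u − α^p)^d)`. [folklore] -/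
theorem births_X_sub_C_pow_mul_eq_expand {K : Type*} [CommRing K] (p : ℕ) [Fact p.Prime] [CharP K p] (α : K) (d : ℕ) :
    (X - C α) ^ (p * d) = expand K p ((X - C (α ^ p)) ^ d) := by
  rw [pow_mul, sub_pow_char (p := p) X (C α), map_pow, map_sub, expand_X, expand_C, C_pow]

/-- **AT MOST ONE NON-DESCENDING RATIONAL BIRTH** (new relative to memo 4e §2.6 (d)): if `F' = 0`, `deg F ≤ p d` with `d ≥ 1`, `F` is not a `p`-th
power, and both `(u − α)^{pd} ∣ F − G₁^p` and `(u − β)^{pd} ∣ F − G₂^p`, then `α = β`.  Proof: the two normal forms give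
`a₁ (u − α)^{pd} − a₂ (u − β)^{pd} = M^p`, i.e. `a₁ (Y − α^p)^d − a₂ (Y − β^p)^d = frob(M)(Y)`; at `Y = α^p` this reads `−a₂ (α − β)^{pd} = M(α)^p`,
so for `α ≠ β` the coefficient `a₂` is a `p`-th power and `F = (P₂ + b (u − β)^d)^p`, contradiction. [folklore] -/
theorem births_corner_unique {K : Type*} [Field K] (p : ℕ) [Fact p.Prime] [CharP K p] {F G₁ G₂ : K[X]} {d : ℕ} (hd : 0 < d)
    (hF' : derivative F = 0) (hdeg : F.natDegree ≤ p * d) (hnot : ∀ H : K[X], F ≠ H ^ p) {α β : K}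
    (hα : (X - C α) ^ (p * d) ∣ F - G₁ ^ p) (hβ : (X - C β) ^ (p * d) ∣ F - G₂ ^ p) : α = β := by
  have hp : p.Prime := Fact.out
  have hp0 : 0 < p := hp.pos
  by_contra hne
  obtain ⟨P₁, a₁, h₁⟩ := births_corner_normalForm_at p hF' hdeg hα
  obtain ⟨P₂, a₂, h₂⟩ := births_corner_normalForm_at p hF' hdeg hβ
  -- `a₁ (u − α)^{pd} − a₂ (u − β)^{pd} = (P₂ − P₁)^p`
  set M : K[X] := P₂ - P₁ with hMdef
  have hkey : C a₁ * (X - C α) ^ (p * d) - C a₂ * (X - C β) ^ (p * d) = M ^ p := by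
    rw [hMdef, sub_pow_char (p := p) P₂ P₁]
    have h := h₁.symm.trans h₂
    linear_combination h
  -- in the `Y = u^p` world: `a₁ (Y − α^p)^d − a₂ (Y − β^p)^d = frob(M)`
  have hY : C a₁ * (X - C (α ^ p)) ^ d - C a₂ * (X - C (β ^ p)) ^ d = map (frobenius K p) M := by
    apply expand_injective hp0
    rw [map_sub, map_mul, map_mul, expand_C, expand_C, ← births_X_sub_C_pow_mul_eq_expand p α d,
      ← births_X_sub_C_pow_mul_eq_expand p β d, hkey, ← map_expand, map_frobenius_expand]
  -- evaluate at `Y = α^p`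
  have hR : (map (frobenius K p) M).eval (frobenius K p α) = frobenius K p (M.eval α) := by
    rw [eval_map, eval₂_at_apply]
  rw [frobenius_def, frobenius_def] at hR
  have hL : (C a₁ * (X - C (α ^ p)) ^ d - C a₂ * (X - C (β ^ p)) ^ d).eval (α ^ p) = -(a₂ * ((α - β) ^ d) ^ p) := by
    rw [eval_sub, eval_mul, eval_mul, eval_C, eval_C, eval_pow, eval_pow, eval_sub, eval_sub, eval_X, eval_C, eval_C,
      sub_self, zero_pow hd.ne', mul_zero, zero_sub, ← sub_pow_char (p := p) α β, ← pow_mul, mul_comm p d, pow_mul]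
  have heval : -(a₂ * ((α - β) ^ d) ^ p) = M.eval α ^ p := by
    rw [← hL, ← hR, hY]
  -- `heval : -(a₂ * ((α - β) ^ d) ^ p) = (eval α M) ^ p`
  have hγ : (α - β) ^ d ≠ 0 := pow_ne_zero d (sub_ne_zero.mpr hne)
  have hγp : ((α - β) ^ d) ^ p ≠ 0 := pow_ne_zero p hγ
  have ha₂ : a₂ = (-(M.eval α) / (α - β) ^ d) ^ p := by
    rw [div_pow, neg_pow, neg_one_pow_char K p, ← heval, neg_one_mul, neg_neg, mul_div_cancel_right₀ _ hγp]
  apply hnot (P₂ + C (-(M.eval α) / (α - β) ^ d) * (X - C β) ^ d)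
  rw [add_pow_char _ _ p, mul_pow, ← map_pow, ← ha₂, ← pow_mul, mul_comm d p]
  exact h₂

end Summit.ResolutionOfSingularities.ResolutionOfSingularities.Theorems.RadicialJung.CleanModels
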